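import Literature.Analysis.Fourier.LatticeStepFourier

/-!
# The Boas–Kac factorisation, Fourier side: `Σᵢ |ĝᵢ|² = |f̂|²` with `supp f ⊆ [0, L]`

**Theorem** (Boas–Kac 1945, Thm 1, in the form needed downstream; Kreĭn; Akhiezer's factorisation of
nonnegative entire functions of exponential type restricted to this case).  Let `g₁, …, g_m : ℝ → ℂ` be
continuous and vanish off `[0, L]`.  Then there is ONE function `f ∈ L²(ℝ)` vanishing off `[0, L]` with
`|𝓕 f(ξ)|² = Σᵢ |𝓕 gᵢ(ξ)|²` for every real `ξ` (`exists_memLp_norm_sq_fourier_eq_sum`).  Equivalently (by the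
convolution theorem and Fourier uniqueness, `BoasKacSmooth.lean`) the sum of the autocorrelations
`gᵢ ⋆ g̃ᵢ` is the single autocorrelation `f ⋆ f̃`; in particular finite sums of autocorrelations of functions
supported in an interval of length `L` are again such autocorrelations (false in dimension `≥ 2`).

Proof (Boas–Kac): discretise at mesh `h = L/(N+1)`: the lattice step functions `Sᵢ` of the samples `gᵢ(kh)`
have `|𝓕 Sᵢ(ξ)|² = |c_h(ξ)|² |Pᵢ(z)|²` (`z = e^{-2πihξ}`, `Pᵢ` the sampling polynomial), the Fejér–Riesz theorem
(sum form) writes `Σᵢ Pᵢ P̄ᵢʳ = Q Q̄ʳ` for one polynomial `Q` of the same degree, and the lattice step function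
`f_N` of `Q` then satisfies `|𝓕 f_N|² = Σᵢ |𝓕 Sᵢ|²` IDENTICALLY, `‖f_N‖₂² = Σᵢ ‖Sᵢ‖₂² ≤ B`, `supp f_N ⊆ [0, L+h]`.
As `N → ∞`, `𝓕 Sᵢ → 𝓕 gᵢ` pointwise (uniform continuity), and a weak cluster point `f` of `(f_N)` in `L²`
(Banach–Alaoglu) vanishes off `[0, L]` and has `𝓕 f(ξ)` a cluster value of `𝓕 f_N(ξ)` for each `ξ`, whence
`|𝓕 f(ξ)|² = lim |𝓕 f_N(ξ)|² = Σᵢ |𝓕 gᵢ(ξ)|²`.  No subsequence and no metrisability is needed: cluster values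
of a convergent real sequence equal its limit.

Not here: the time-side statement and the smooth upgrade (`BoasKacSmooth.lean`), uniqueness of
`f` up to the usual symmetries, the positive-definite-function formulation. [cite: BoasKac1945, Thm 1]
-/

noncomputable section

open Polynomial Filter MeasureTheory Set FourierTransform
open _root_.Complex _root_.Real
open scoped ComplexConjugate ComplexOrder Topology

namespace Literature.Analysis.Fourier.BoasKac

open Literature.Analysis.Fourier.FejerRiesz Literature.Analysis.Fourier.LatticeStep

/-! ## Two facts on cluster values of sequences -/

/-- A cluster value of a convergent sequence (in a Hausdorff space) is its limit. [folklore] -/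
theorem eq_of_mapClusterPt_of_tendsto {X : Type*} [TopologicalSpace X] [T2Space X] {u : ℕ → X} {a b : X}
    (hb : MapClusterPt b atTop u) (ha : Tendsto u atTop (𝓝 a)) : b = a :=
  t2_iff_nhds.mp ‹T2Space X› (ClusterPt.mono hb ha)

/-- A cluster value of an eventually constant sequence is that constant. [folklore] -/
theorem eq_of_mapClusterPt_of_eventuallyEq {X : Type*} [TopologicalSpace X] [T2Space X] {u : ℕ → X}
    {a b : X} (hb : MapClusterPt b atTop u) (ha : ∀ᶠ N in atTop, u N = a) : b = a :=
  eq_of_mapClusterPt_of_tendsto hb (tendsto_const_nhds.congr' (EventuallyEq.symm ha))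

/-! ## Weak cluster points of bounded sequences in a Hilbert space -/

section Hilbert

variable {H : Type*} [NormedAddCommGroup H] [InnerProductSpace ℂ H] [CompleteSpace H]

/-- **Banach–Alaoglu for sequences in a Hilbert space, cluster-value form.**  A bounded sequence `u` in a
complex Hilbert space has a vector `f` such that, for every `v`, `⟪f, v⟫` is a cluster value of
`N ↦ ⟪u N, v⟫`. [folklore] -/
theorem exists_inner_mapClusterPt_of_bounded {u : ℕ → H} {R : ℝ} (hu : ∀ N, ‖u N‖ ≤ R) :
    ∃ f : H, ∀ v : H, MapClusterPt (inner ℂ f v) atTop fun N => inner ℂ (u N) v := by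
  set ψ : ℕ → WeakDual ℂ H := fun N => StrongDual.toWeakDual (InnerProductSpace.toDual ℂ H (u N)) with hψ
  set K : Set (WeakDual ℂ H) := WeakDual.toStrongDual ⁻¹' Metric.closedBall 0 R with hK
  have hKc : IsCompact K := WeakDual.isCompact_closedBall 0 R
  have hmem : ∀ N, ψ N ∈ K := fun N => by
    simp only [hK, hψ, Set.mem_preimage, Metric.mem_closedBall, dist_zero_right]
    change ‖(InnerProductSpace.toDual ℂ H) (u N)‖ ≤ R
    rw [LinearIsometryEquiv.norm_map]; exact hu N
  obtain ⟨φ, _, hφ⟩ := hKc.exists_clusterPt (f := map ψ atTop)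
    (le_principal_iff.mpr (mem_map.mpr (Eventually.of_forall hmem)))
  refine ⟨(InnerProductSpace.toDual ℂ H).symm (WeakDual.toStrongDual φ), fun v => ?_⟩
  have hev : Continuous fun x : WeakDual ℂ H => x v := (continuous_apply v).comp WeakDual.coeFn_continuous
  have hcl : ClusterPt (φ v) (map (fun x : WeakDual ℂ H => x v) (map ψ atTop)) :=
    hφ.map hev.continuousAt tendsto_map
  rw [map_map] at hcl
  have h1 : inner ℂ ((InnerProductSpace.toDual ℂ H).symm (WeakDual.toStrongDual φ)) v = φ v := by
    rw [InnerProductSpace.toDual_symm_apply, WeakDual.toStrongDual_apply]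
  have h2 : ((fun x : WeakDual ℂ H => x v) ∘ ψ) = fun N => inner ℂ (u N) v := by
    funext N
    simp only [Function.comp_apply, hψ, StrongDual.toWeakDual_apply, InnerProductSpace.toDual_apply_apply]
  rw [h2] at hcl; rw [h1]; exact hcl

end Hilbert

/-! ## The discretisation -/

section Setup

variable {ι : Type*} [Fintype ι] {L : ℝ}

/-- **The approximants carry the summed spectral density exactly**: `|𝓕 f_N(ξ)|² = Σᵢ |𝓕 Sᵢ(ξ)|²`.
[cite: BoasKac1945, Thm 1] -/
theorem norm_sq_fourier_approx (hL : 0 < L) (g : ι → ℝ → ℂ) (N : ℕ) (ξ : ℝ) :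
    ‖𝓕 (approx L g N) ξ‖ ^ 2 = ∑ i, ‖𝓕 (sampleStep L g N i) ξ‖ ^ 2 := by
  have h1 := normSq_fourier_latticeStep (mesh_pos hL N) (natDegree_frFactor_le L g N) ξ
  rw [← frFactor_spec L g N, eval_finsetSum, Finset.mul_sum, Finset.mul_sum] at h1
  have h2 : (normSq (𝓕 (approx L g N) ξ) : ℂ) = ∑ i, (normSq (𝓕 (sampleStep L g N i) ξ) : ℂ) := by
    rw [approx, h1]
    refine Finset.sum_congr rfl fun i _ => ?_
    rw [sampleStep]
    exact (normSq_fourier_latticeStep (Q := samplePolys L g N i) (mesh_pos hL N)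
      (natDegree_samplePoly_le _ _ _) ξ).symm
  simp_rw [normSq_eq_norm_sq] at h2
  exact_mod_cast h2

/-- `‖f_N‖₂² = Σᵢ h Σ_k |gᵢ(kh)|²`. [folklore] -/
theorem integral_norm_sq_approx (hL : 0 < L) (g : ι → ℝ → ℂ) (N : ℕ) :
    ∫ x, ‖approx L g N x‖ ^ 2 =
      ∑ i, mesh L N * ∑ k ∈ Finset.range (N + 1 + 1), ‖g i (k * mesh L N)‖ ^ 2 := by
  rw [approx, integral_norm_sq_latticeStep (mesh_pos hL N) (natDegree_frFactor_le L g N),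
    sum_norm_sq_coeff_eq_re_coeff, ← frFactor_spec L g N, finsetSum_coeff, Complex.re_sum, Finset.mul_sum]
  refine Finset.sum_congr rfl fun i _ => ?_
  rw [← sum_norm_sq_coeff_eq_re_coeff]
  congr 1
  refine Finset.sum_congr rfl fun k hk => ?_
  rw [samplePolys, coeff_samplePoly_of_le (Nat.lt_succ_iff.mp (Finset.mem_range.mp hk))]

/-- Uniform `L²` bound: if `|gᵢ| ≤ M` then `‖f_N‖₂² ≤ #ι · 2L · M²`. [folklore] -/
theorem integral_norm_sq_approx_le (hL : 0 < L) {g : ι → ℝ → ℂ} {M : ℝ} (hM : ∀ i x, ‖g i x‖ ≤ M) (N : ℕ) :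
    ∫ x, ‖approx L g N x‖ ^ 2 ≤ Fintype.card ι * (2 * L * M ^ 2) := by
  rw [integral_norm_sq_approx hL g N]
  calc ∑ i, mesh L N * ∑ k ∈ Finset.range (N + 1 + 1), ‖g i (k * mesh L N)‖ ^ 2
      ≤ ∑ _i : ι, mesh L N * ∑ _k ∈ Finset.range (N + 1 + 1), M ^ 2 := by
        gcongr with i _ k _
        · exact (mesh_pos hL N).le
        · exact hM i _
    _ = Fintype.card ι * ((((N + 1 : ℕ) : ℝ) + 1) * mesh L N * M ^ 2) := by
        rw [Finset.sum_const, Finset.card_univ, nsmul_eq_mul, Finset.sum_const, Finset.card_range, nsmul_eq_mul]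
        push_cast; ring
    _ ≤ Fintype.card ι * (2 * L * M ^ 2) := by
        rw [cells_mul_mesh hL N]
        gcongr
        linarith [mesh_le hL N]

/-- The approximants vanish off `[0, L + h_N)`. [folklore] -/
theorem approx_eq_zero (hL : 0 < L) (g : ι → ℝ → ℂ) (N : ℕ) {x : ℝ} (hx : x ∉ Ico 0 (L + mesh L N)) :
    approx L g N x = 0 := by
  rw [← cells_mul_mesh hL N] at hx
  exact latticeStep_eq_zero_of_not_mem (mesh_pos hL N) (natDegree_frFactor_le L g N) hx

/-- The approximants are measurable. [folklore] -/
theorem measurable_approx (g : ι → ℝ → ℂ) (N : ℕ) : Measurable (approx L g N) := measurable_latticeStep _ _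

/-- The approximants are in `L²`. [folklore] -/
theorem memLp_approx (hL : 0 < L) (g : ι → ℝ → ℂ) (N : ℕ) : MemLp (approx L g N) 2 volume :=
  memLp_two_latticeStep (mesh_pos hL N) (natDegree_frFactor_le L g N)

/-- The approximants are integrable. [folklore] -/
theorem integrable_approx (hL : 0 < L) (g : ι → ℝ → ℂ) (N : ℕ) : Integrable (approx L g N) :=
  integrable_latticeStep (mesh_pos hL N) (natDegree_frFactor_le L g N)

omit [Fintype ι] in
/-- **Convergence of the sampled transforms**: `𝓕 Sᵢ(ξ) → 𝓕 gᵢ(ξ)` as `N → ∞`, for `gᵢ` continuous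
vanishing off `[0, L]`. [folklore] -/
theorem tendsto_fourier_sampleStep (hL : 0 < L) {g : ι → ℝ → ℂ} (i : ι) (hcont : Continuous (g i))
    (hsupp : ∀ x ∉ Icc 0 L, g i x = 0) (ξ : ℝ) :
    Tendsto (fun N => 𝓕 (sampleStep L g N i) ξ) atTop (𝓝 (𝓕 (g i) ξ)) := by
  have hcs : HasCompactSupport (g i) := by
    refine HasCompactSupport.intro isCompact_Icc fun x hx => hsupp x hx
  have huc : UniformContinuous (g i) := hcs.uniformContinuous_of_continuous hcont
  have hgi : Integrable (g i) := hcont.integrable_of_hasCompactSupport hcs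
  rw [Metric.tendsto_atTop]
  intro ε hε
  set ε' : ℝ := ε / (2 * L + 1) with hε'
  have hε'pos : 0 < ε' := by positivity
  obtain ⟨δ, hδ, hδmod⟩ := Metric.uniformContinuous_iff.mp huc ε' hε'pos
  obtain ⟨N₀, hN₀⟩ := (Metric.tendsto_atTop.mp (tendsto_mesh L)) δ hδ
  refine ⟨N₀, fun N hN => ?_⟩
  have hmeshδ : mesh L N < δ := by
    have := hN₀ N hN; rw [dist_zero_right, Real.norm_eq_abs, abs_of_pos (mesh_pos hL N)] at this; exact this
  have hbound := norm_fourier_sub_fourier_le (T := 2 * L) (ε := ε')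
    (integrable_latticeStep (mesh_pos hL N) (natDegree_samplePoly_le _ _ _)) hgi (by positivity)
    (fun x hx => latticeStep_eq_zero_of_not_mem (mesh_pos hL N) (natDegree_samplePoly_le _ _ _) fun hx' =>
      hx ⟨hx'.1, by rw [cells_mul_mesh hL N] at hx'; linarith [hx'.2, mesh_le hL N]⟩)
    (fun x hx => hsupp x fun hx' => hx ⟨hx'.1, by linarith [hx'.2]⟩)
    (fun x => norm_latticeStep_samplePoly_sub_le (mesh_pos hL N) (fun x hx => hsupp x fun h' => by
        linarith [h'.1]) (fun x hx => hsupp x fun h' => by linarith [h'.2]) (lt_cells_mul_mesh hL N)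
      (fun x y hxy => by simpa only [dist_eq_norm] using (hδmod (lt_of_le_of_lt hxy hmeshδ)).le) x) ξ
  rw [dist_eq_norm]
  calc ‖𝓕 (sampleStep L g N i) ξ - 𝓕 (g i) ξ‖ ≤ ε' * (2 * L) := hbound
    _ < ε := by rw [hε', div_mul_eq_mul_div, div_lt_iff₀ (by positivity)]; nlinarith

/-- Hence `|𝓕 f_N(ξ)|² → Σᵢ |𝓕 gᵢ(ξ)|²`. [folklore] -/
theorem tendsto_norm_sq_fourier_approx (hL : 0 < L) {g : ι → ℝ → ℂ} (hcont : ∀ i, Continuous (g i))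
    (hsupp : ∀ i, ∀ x ∉ Icc 0 L, g i x = 0) (ξ : ℝ) :
    Tendsto (fun N => ‖𝓕 (approx L g N) ξ‖ ^ 2) atTop (𝓝 (∑ i, ‖𝓕 (g i) ξ‖ ^ 2)) := by
  simp_rw [norm_sq_fourier_approx hL]
  exact tendsto_finsetSum _ fun i _ => ((tendsto_fourier_sampleStep hL i (hcont i) (hsupp i) ξ).norm).pow 2

end Setup

/-! ## The limit -/

section Limit

variable {ι : Type*} [Fintype ι] {L : ℝ}

/-- Inner products of `toLp`'s are the expected integrals: `⟪u, v⟫ = ∫ v · conj u`. [folklore] -/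
theorem inner_toLp_toLp {u v : ℝ → ℂ} (hu : MemLp u 2 volume) (hv : MemLp v 2 volume) :
    inner ℂ (hu.toLp u) (hv.toLp v) = ∫ x, v x * conj (u x) := by
  rw [L2.inner_def]
  refine integral_congr_ae ?_
  filter_upwards [hu.coeFn_toLp, hv.coeFn_toLp] with x hux hvx
  rw [hux, hvx, RCLike.inner_apply]

/-- `‖toLp u‖ ≤ √B` when `∫ |u|² ≤ B`. [folklore] -/
theorem norm_toLp_le {u : ℝ → ℂ} (hu : MemLp u 2 volume) {B : ℝ} (hB : ∫ x, ‖u x‖ ^ 2 ≤ B) :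
    ‖hu.toLp u‖ ≤ Real.sqrt B := by
  rw [Lp.norm_toLp, hu.eLpNorm_eq_integral_rpow_norm two_ne_zero ENNReal.ofNat_ne_top]
  simp only [ENNReal.toReal_ofNat, Real.rpow_two]
  rw [ENNReal.toReal_ofReal (by positivity), Real.sqrt_eq_rpow, show (2 : ℝ)⁻¹ = 1 / 2 by norm_num]
  exact Real.rpow_le_rpow (integral_nonneg fun _ => by positivity) hB (by norm_num)

/-- Cluster values pass through continuous maps. [folklore] -/
theorem mapClusterPt_comp {X Y : Type*} [TopologicalSpace X] [TopologicalSpace Y] {u : ℕ → X} {x : X}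
    {φ : X → Y} (h : MapClusterPt x atTop u) (hφ : Continuous φ) : MapClusterPt (φ x) atTop (φ ∘ u) := by
  have := ClusterPt.map h hφ.continuousAt (tendsto_map (f := φ))
  rwa [map_map] at this

/-- A square-integrable test vector: a bounded measurable function cut off to `[0, T]`. [folklore] -/
theorem memLp_two_indicator_Icc {e : ℝ → ℂ} (he : Continuous e) {C : ℝ} (hC : ∀ x, ‖e x‖ ≤ C) (a b : ℝ) :
    MemLp ((Icc a b).indicator e) 2 volume := by
  rw [memLp_indicator_iff_restrict measurableSet_Icc]
  exact MemLp.of_bound he.aestronglyMeasurable C (Eventually.of_forall hC)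

/-- **Boas–Kac factorisation, Fourier side.**  For finitely many continuous `gᵢ : ℝ → ℂ` vanishing off
`[0, L]` there is `f ∈ L²(ℝ)` vanishing off `[0, L]` with `|𝓕 f(ξ)|² = Σᵢ |𝓕 gᵢ(ξ)|²` for every `ξ`.
[cite: BoasKac1945, Thm 1] -/
theorem exists_memLp_norm_sq_fourier_eq_sum (hL : 0 < L) (g : ι → ℝ → ℂ) (hcont : ∀ i, Continuous (g i))
    (hsupp : ∀ i, ∀ x ∉ Icc 0 L, g i x = 0) :
    ∃ f : ℝ → ℂ, MemLp f 2 volume ∧ (∀ x ∉ Icc 0 L, f x = 0) ∧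
      ∀ ξ : ℝ, ‖𝓕 f ξ‖ ^ 2 = ∑ i, ‖𝓕 (g i) ξ‖ ^ 2 := by
  -- a uniform bound on the `gᵢ`
  have hbd : ∀ i, ∃ M, ∀ x, ‖g i x‖ ≤ M := fun i =>
    (hcont i).bounded_above_of_compact_support (HasCompactSupport.intro isCompact_Icc (hsupp i))
  choose M hM using hbd
  set M₀ : ℝ := ∑ i, |M i| with hM₀
  have hM' : ∀ i x, ‖g i x‖ ≤ M₀ := fun i x =>
    (hM i x).trans ((le_abs_self _).trans
      (Finset.single_le_sum (f := fun j => |M j|) (fun j _ => abs_nonneg (M j)) (Finset.mem_univ i)))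
  -- the approximants as a bounded sequence in `L²`, and a weak cluster point
  set u : ℕ → Lp ℂ 2 (volume : Measure ℝ) := fun N => (memLp_approx hL g N).toLp (approx L g N) with hu
  have hnorm : ∀ N, ‖u N‖ ≤ Real.sqrt (Fintype.card ι * (2 * L * M₀ ^ 2)) := fun N =>
    norm_toLp_le _ (integral_norm_sq_approx_le hL hM' N)
  obtain ⟨fH, hfH⟩ := exists_inner_mapClusterPt_of_bounded hnorm
  set F : ℝ → ℂ := (fH : ℝ → ℂ) with hF
  have hFmem : MemLp F 2 volume := Lp.memLp fH
  have hcluster : ∀ {v : ℝ → ℂ} (hv : MemLp v 2 volume),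
      MapClusterPt (∫ x, v x * conj (F x)) atTop fun N => ∫ x, v x * conj (approx L g N x) := by
    intro v hv
    have h := hfH (hv.toLp v)
    have e1 : inner ℂ fH (hv.toLp v) = ∫ x, v x * conj (F x) := by
      convert inner_toLp_toLp hFmem hv using 2
      exact (Lp.toLp_coeFn fH hFmem).symm
    have e2 : (fun N => inner ℂ (u N) (hv.toLp v)) = fun N => ∫ x, v x * conj (approx L g N x) := by
      funext N; exact inner_toLp_toLp _ hv
    rwa [e1, e2] at h
  -- (1) `F` vanishes a.e. on every set eventually avoided by the approximants
  have hvanish : ∀ {S : Set ℝ}, MeasurableSet S → (∀ᶠ N in atTop, ∀ x ∈ S, approx L g N x = 0) →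
      ∀ᵐ x, x ∈ S → F x = 0 := by
    intro S hS hev
    have hv : MemLp (S.indicator F) 2 volume := hFmem.indicator hS
    have hzero : ∀ᶠ N in atTop, (∫ x, S.indicator F x * conj (approx L g N x)) = 0 := by
      filter_upwards [hev] with N hN
      refine integral_eq_zero_of_ae (Eventually.of_forall fun x => ?_)
      by_cases hx : x ∈ S
      · simp only [Pi.zero_apply]; rw [hN x hx, map_zero, mul_zero]
      · simp only [Pi.zero_apply]; rw [indicator_of_notMem hx, zero_mul]
    have hlim := eq_of_mapClusterPt_of_eventuallyEq (hcluster hv) hzero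
    have hint : ∫ x, S.indicator F x * conj (F x) = ((∫ x, S.indicator (fun x => ‖F x‖ ^ 2) x : ℝ) : ℂ) := by
      rw [← integral_complex_ofReal]
      refine integral_congr_ae (Eventually.of_forall fun x => ?_)
      beta_reduce
      by_cases hx : x ∈ S
      · rw [indicator_of_mem hx, indicator_of_mem hx, mul_conj, normSq_eq_norm_sq]
      · rw [indicator_of_notMem hx, indicator_of_notMem hx, zero_mul, Complex.ofReal_zero]
    rw [hint] at hlim
    have hlim' : ∫ x, S.indicator (fun x => ‖F x‖ ^ 2) x = 0 := by exact_mod_cast hlim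
    have hnn : 0 ≤ fun x => S.indicator (fun x => ‖F x‖ ^ 2) x :=
      fun x => indicator_nonneg (fun _ _ => by positivity) _
    have hintg : Integrable (fun x => S.indicator (fun x => ‖F x‖ ^ 2) x) :=
      ((memLp_two_iff_integrable_sq_norm hFmem.1).mp hFmem).indicator hS
    filter_upwards [(integral_eq_zero_iff_of_nonneg hnn hintg).mp hlim'] with x hx hxS
    have h2 : ‖F x‖ ^ 2 = 0 := by simpa [indicator_of_mem hxS] using hx
    exact norm_eq_zero.mp (pow_eq_zero_iff two_ne_zero |>.mp h2)
  have hneg : ∀ᵐ x, x ∈ Iio (0 : ℝ) → F x = 0 :=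
    hvanish measurableSet_Iio (Eventually.of_forall fun N x hx =>
      approx_eq_zero hL g N fun h' => not_le.mpr (mem_Iio.mp hx) h'.1)
  have hmesh_ev : ∀ δ : ℝ, 0 < δ → ∀ᶠ N in atTop, mesh L N < δ := fun δ hδ => by
    obtain ⟨N₀, hN₀⟩ := (Metric.tendsto_atTop.mp (tendsto_mesh L)) δ hδ
    refine eventually_atTop.mpr ⟨N₀, fun N hN => ?_⟩
    have := hN₀ N hN
    rwa [dist_zero_right, Real.norm_eq_abs, abs_of_pos (mesh_pos hL N)] at this
  have hpos : ∀ m : ℕ, ∀ᵐ x, x ∈ Ioi (L + 1 / ((m : ℝ) + 1)) → F x = 0 := fun m => by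
    refine hvanish measurableSet_Ioi ?_
    filter_upwards [hmesh_ev (1 / ((m : ℝ) + 1)) (by positivity)] with N hN x hx
    exact approx_eq_zero hL g N fun h' => by linarith [h'.2, mem_Ioi.mp hx]
  -- the representative `f = 𝟙_{[0,L]} F`
  set f : ℝ → ℂ := (Icc 0 L).indicator F with hf
  have hFf : ∀ᵐ x, F x = f x := by
    rw [← ae_all_iff] at hpos
    filter_upwards [hneg, hpos] with x hxneg hxpos
    by_cases hxI : x ∈ Icc 0 L
    · rw [hf, indicator_of_mem hxI]
    · rw [hf, indicator_of_notMem hxI]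
      rcases lt_or_ge x 0 with h0 | h0
      · exact hxneg h0
      · have hxL : L < x := not_le.mp fun h' => hxI ⟨h0, h'⟩
        obtain ⟨m, hm⟩ := exists_nat_one_div_lt (sub_pos.mpr hxL)
        exact hxpos m (by rw [mem_Ioi]; linarith)
  have hfmem : MemLp f 2 volume := MemLp.ae_eq hFf hFmem
  refine ⟨f, hfmem, fun x hx => indicator_of_notMem hx _, fun ξ => ?_⟩
  -- (2) the Fourier identity at `ξ`: test against `e = 𝟙_{[0,2L]} · conj (𝐞(-xξ))`
  set e : ℝ → ℂ := (Icc 0 (2 * L)).indicator (fun x => conj ((𝐞 (-(x * ξ)) : ℂ))) with he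
  have hemem : MemLp e 2 volume :=
    memLp_two_indicator_Icc (by fun_prop) (C := 1) (fun x => by rw [norm_conj, Circle.norm_coe]) 0 (2 * L)
  have hcl := hcluster hemem
  -- the approximant side: `∫ e · conj f_N = conj (𝓕 f_N ξ)`
  have happ : (fun N => ∫ x, e x * conj (approx L g N x)) = fun N => conj (𝓕 (approx L g N) ξ) := by
    funext N
    rw [Real.fourier_real_eq, ← integral_conj]
    refine integral_congr_ae (Eventually.of_forall fun x => ?_)
    beta_reduce
    by_cases hx : x ∈ Icc 0 (2 * L)
    · rw [he, indicator_of_mem hx, Circle.smul_def, smul_eq_mul, map_mul]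
    · rw [approx_eq_zero hL g N fun h' => hx ⟨h'.1, by linarith [h'.2, mesh_le hL N]⟩, map_zero, mul_zero,
        smul_zero, map_zero]
  -- the limit side: `∫ e · conj F = conj (𝓕 f ξ)`
  have hlimside : ∫ x, e x * conj (F x) = conj (𝓕 f ξ) := by
    rw [Real.fourier_real_eq, ← integral_conj]
    refine integral_congr_ae ?_
    filter_upwards [hFf] with x hx
    rw [hx]
    by_cases hxI : x ∈ Icc 0 (2 * L)
    · rw [he, indicator_of_mem hxI, Circle.smul_def, smul_eq_mul, map_mul]
    · have hxI' : x ∉ Icc 0 L := fun h' => hxI ⟨h'.1, by linarith [h'.2]⟩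
      rw [he, indicator_of_notMem hxI, zero_mul, hf, indicator_of_notMem hxI', smul_zero, map_zero]
  rw [happ, hlimside] at hcl
  have hcl2 := mapClusterPt_comp hcl continuous_normSq
  have hseq : (normSq ∘ fun N => conj (𝓕 (approx L g N) ξ)) = fun N => ‖𝓕 (approx L g N) ξ‖ ^ 2 := by
    funext N; simp [normSq_eq_norm_sq]
  rw [hseq, normSq_conj, normSq_eq_norm_sq] at hcl2
  exact eq_of_mapClusterPt_of_tendsto hcl2 (tendsto_norm_sq_fourier_approx hL hcont hsupp ξ)

end Limit

end Literature.Analysis.Fourier.BoasKac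

end
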